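import Literature.AlgebraicGeometry.Resolution.WeightedCentreStepUmbrellaReplay
import HarnessLib

/-!
# Nonlinear shears dominated by the weights preserve the monomial valuation (centre-side rigidity)

[ATW24] Abramovich–Temkin–Włodarczyk, *Functorial embedded resolution via weighted blowings up*, Algebra & Number
Theory 18 (2024): Lemma 5.2.10 (p. 1577: "(x₁^{a₁}, …, x_k^{a_k}) ≤ v(x₁'^{a₁}) implies … the two centers coincide" —
ONE parameter is replaced by one of at least the same valuation), Def. 2.2.1 (p. 1567: the valuation ideals `I_γ`),
Def. 2.4.1 (2)–(3) (p. 1568: admissibility `J ≤ v(I)`, reduced integer weights), Thm. 5.3.1 (3) (p. 1578).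
[CJS20] Cossart–Jannsen–Saito, LNM 2270 (2020), Def. 8.2 / Thm. 8.16 (pp. 118–121: the coordinate changes
`y ↦ y + q(u)` with `q` a polynomial in the other variables of weight at least that of `y`).

## What is proved (polynomial model; `K` a field, finitely many variables)

* **`monomialOrd_addPolyShear_eq`** — if `ν_w(q̄) ≥ w_a` (`q̄ = killVar a q`, `q` with the `X_a`-monomials deleted), the
  elementary automorphism `X_a ↦ X_a + q̄` (every other variable fixed) satisfies `ν_w(shear F) = ν_w(F)` for EVERY `F`; the
  same for its inverse `X_a ↦ X_a − q̄` (`monomialOrd_addPolyShear_symm_eq`).  This is the many-`F` form of Lemma 5.2.10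
  for the move "replace one parameter `z_a` by `z_a ± g(z_{≠a})` with `v(g) ≥ w_a`": both the shear and its inverse
  dominate the weights, and rigidity of the monomial valuation (`monomialOrd_ringEquiv_eq`, Noetherian fixed-point
  argument already in the tree) gives equality.
* **`isAdmissibleFor_addPolyShear_iff`** — the rational form: for a cocharacter `γ ≥ 0` and `g` free of `X_a` with
  `v_γ(u^d) ≥ γ_a` on every monomial of `g`, `γ` is admissible for `shear F` iff it is admissible for `F` (clear
  denominators with `exists_nat_weights`, then the integer statement).
* **`IsCentreFor.shearParam`** — CENTRE SIDE: if `(Ψ, γ)` is a centre for `f` (parameters `zᵢ = Ψ Xᵢ`) and `g` is free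
  of `X_a`, vanishes at the origin and has `v_γ ≥ γ_a` on its monomials, then the parameters `z'` with `z'_a = z_a − g(z)`,
  `z'_i = z_i` — the automorphism `(addPolyShear a g).symm.trans Ψ` — form, with the SAME `γ`, again a centre for `f`
  (`IsCentreFor.shearParam_iff`: and conversely); in particular the invariant `exps γ ∈ W(f)` is presented by both.

Value type: typed lemmas in the polynomial `W(f)` model (infrastructure for centre normal forms) — not a resolution theorem.
-/

noncomputable section

open MvPolynomial

namespace Literature.AlgebraicGeometry.Resolution

namespace WeightedBlowup

/-! ## §1 Integer weights: the shear and its inverse preserve `ν_w` -/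

section NatWeights

variable {σ : Type*} [DecidableEq σ] {K : Type*} [Field K]

/-- The shear dominates the weights: `ν_w(shear Xᵢ) ≥ wᵢ` for all `i`, as soon as `ν_w(q̄) ≥ w_a` (plumbing).
[cite: AbramovichTemkinWlodarczyk2024, Lemma 5.2.10 (p. 1577)] -/
private theorem le_monomialOrd_addPolyShear_X (w : σ → ℕ) (a : σ) {q : MvPolynomial σ K}
    (hq : (w a : ℕ∞) ≤ monomialOrd w (killVar a q)) (i : σ) :
    (w i : ℕ∞) ≤ monomialOrd w (addPolyShear a q (X i)) := by
  by_cases hi : i = a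
  · subst hi
    rw [addPolyShear_X_self]
    refine le_trans (le_min ?_ hq) (min_monomialOrd_le_add w _ _)
    rw [monomialOrd_X]
  · rw [addPolyShear_X_of_ne a q hi, monomialOrd_X]

/-- The inverse shear dominates the weights too (plumbing). [cite: AbramovichTemkinWlodarczyk2024, Lemma 5.2.10 (p. 1577)] -/
private theorem le_monomialOrd_addPolyShear_symm_X (w : σ → ℕ) (a : σ) {q : MvPolynomial σ K}
    (hq : (w a : ℕ∞) ≤ monomialOrd w (killVar a q)) (i : σ) :
    (w i : ℕ∞) ≤ monomialOrd w ((addPolyShear a q).symm (X i)) := by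
  by_cases hi : i = a
  · subst hi
    have h : (addPolyShear i q).symm (X i : MvPolynomial σ K) = X i + -killVar i q := by
      simp [addPolyShear]
    rw [h]
    refine le_trans (le_min ?_ ?_) (min_monomialOrd_le_add w _ _)
    · rw [monomialOrd_X]
    · rw [show -killVar i q = C (-1 : K) * killVar i q by rw [C_neg, C_1, neg_one_mul]]
      rwa [monomialOrd_mul_of_constantCoeff_ne_zero w (by rw [constantCoeff_C]; exact neg_ne_zero.2 one_ne_zero)]
  · have h : (addPolyShear a q).symm (X i : MvPolynomial σ K) = X i := by simp [addPolyShear, hi]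
    rw [h, monomialOrd_X]

/-- **The shear `X_a ↦ X_a + q̄` with `ν_w(q̄) ≥ w_a` preserves the monomial valuation: `ν_w(shear F) = ν_w(F)` for
every `F`.** (derived here) [cite: AbramovichTemkinWlodarczyk2024, Lemma 5.2.10 (p. 1577), Def. 2.2.1 (p. 1567)]
[cite: CossartJannsenSaito2020, Def. 8.2 / Thm. 8.16 (pp. 118–121)] -/
theorem monomialOrd_addPolyShear_eq [Finite σ] (w : σ → ℕ) (a : σ) {q : MvPolynomial σ K}
    (hq : (w a : ℕ∞) ≤ monomialOrd w (killVar a q)) (F : MvPolynomial σ K) :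
    monomialOrd w (addPolyShear a q F) = monomialOrd w F :=
  monomialOrd_ringEquiv_eq w (addPolyShear a q : MvPolynomial σ K ≃+* MvPolynomial σ K)
    (le_monomialOrd_addPolyShear_X w a hq) F

/-- **The inverse shear `X_a ↦ X_a − q̄` preserves the monomial valuation as well.** (derived here)
[cite: AbramovichTemkinWlodarczyk2024, Lemma 5.2.10 (p. 1577)] -/
theorem monomialOrd_addPolyShear_symm_eq [Finite σ] (w : σ → ℕ) (a : σ) {q : MvPolynomial σ K}
    (hq : (w a : ℕ∞) ≤ monomialOrd w (killVar a q)) (F : MvPolynomial σ K) :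
    monomialOrd w ((addPolyShear a q).symm F) = monomialOrd w F :=
  monomialOrd_ringEquiv_symm_eq w (addPolyShear a q : MvPolynomial σ K ≃+* MvPolynomial σ K)
    (le_monomialOrd_addPolyShear_X w a hq) F

/-- For `q` free of `X_a` the hypothesis reads `ν_w(q) ≥ w_a`. (derived here) [cite: AbramovichTemkinWlodarczyk2024, Lemma 5.2.10 (p. 1577)] -/
theorem monomialOrd_addPolyShear_eq_of_notMem [Finite σ] (w : σ → ℕ) (a : σ) {q : MvPolynomial σ K} (ha : a ∉ q.vars)
    (hq : (w a : ℕ∞) ≤ monomialOrd w q) (F : MvPolynomial σ K) :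
    monomialOrd w (addPolyShear a q F) = monomialOrd w F :=
  monomialOrd_addPolyShear_eq w a (by rwa [killVar_eq_self_of_notMem ha]) F

end NatWeights

/-! ## §2 Rational cocharacters: admissibility is unchanged -/

section RatWeights

variable {σ : Type*} [DecidableEq σ] [Fintype σ] {K : Type*} [Field K]

omit [DecidableEq σ] [Fintype σ] in
/-- `N · v_γ(u^d) = weight_w(d)` for integer weights `w = N γ` (plumbing). [cite: AbramovichTemkinWlodarczyk2024, Def. 2.4.1 (3) (p. 1568)] -/
private theorem mul_monomialValuation_eq_weight (γ : σ → ℚ) (w : σ → ℕ) {N : ℕ} (hw : ∀ i, (w i : ℚ) = N * γ i)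
    (d : σ →₀ ℕ) : (N : ℚ) * monomialValuation γ d = (Finsupp.weight w d : ℚ) := by
  rw [monomialValuation, Finsupp.sum, Finset.mul_sum, Finsupp.weight_apply, Finsupp.sum, Nat.cast_sum]
  refine Finset.sum_congr rfl fun i _ => ?_
  rw [smul_eq_mul, Nat.cast_mul, hw i]
  ring

omit [DecidableEq σ] [Fintype σ] in
/-- `v_γ ≥ γ_a` on the monomials of `g` gives `ν_w(g) ≥ w_a` for `w = N γ` (plumbing).
[cite: AbramovichTemkinWlodarczyk2024, Def. 2.4.1 (3) (p. 1568)] -/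
private theorem le_monomialOrd_of_forall_le_monomialValuation (γ : σ → ℚ) (w : σ → ℕ) {N : ℕ}
    (hw : ∀ i, (w i : ℚ) = N * γ i) (a : σ) {g : MvPolynomial σ K}
    (hg : ∀ d ∈ g.support, γ a ≤ monomialValuation γ d) : (w a : ℕ∞) ≤ monomialOrd w g := by
  rw [le_monomialOrd_iff]
  intro d hd
  have h : (N : ℚ) * γ a ≤ (N : ℚ) * monomialValuation γ d :=
    mul_le_mul_of_nonneg_left (hg d hd) (Nat.cast_nonneg N)
  rw [mul_monomialValuation_eq_weight γ w hw, ← hw a] at h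
  exact_mod_cast h

/-- **Admissibility of `γ` is unchanged by the shear `X_a ↦ X_a + g`** (`g` free of `X_a`, `v_γ ≥ γ_a` on its monomials,
`γ ≥ 0`). (derived here) [cite: AbramovichTemkinWlodarczyk2024, Lemma 5.2.10 (p. 1577), Def. 2.4.1 (2)–(3) / Rem. 5.2.3 (pp. 1568, 1576)] -/
theorem isAdmissibleFor_addPolyShear_iff (γ : σ → ℚ) (hγ : ∀ i, 0 ≤ γ i) (a : σ) {g : MvPolynomial σ K}
    (ha : a ∉ g.vars) (hg : ∀ d ∈ g.support, γ a ≤ monomialValuation γ d) (F : MvPolynomial σ K) :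
    IsAdmissibleFor γ (addPolyShear a g F) ↔ IsAdmissibleFor γ F := by
  obtain ⟨N, w, hN, hw⟩ := exists_nat_weights γ hγ
  rw [isAdmissibleFor_iff_le_monomialOrd γ w hN hw, isAdmissibleFor_iff_le_monomialOrd γ w hN hw,
    monomialOrd_addPolyShear_eq_of_notMem w a ha (le_monomialOrd_of_forall_le_monomialValuation γ w hw a hg)]

/-- The same for the inverse shear `X_a ↦ X_a − g`. (derived here) [cite: AbramovichTemkinWlodarczyk2024, Lemma 5.2.10 (p. 1577)] -/
theorem isAdmissibleFor_addPolyShear_symm_iff (γ : σ → ℚ) (hγ : ∀ i, 0 ≤ γ i) (a : σ) {g : MvPolynomial σ K}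
    (ha : a ∉ g.vars) (hg : ∀ d ∈ g.support, γ a ≤ monomialValuation γ d) (F : MvPolynomial σ K) :
    IsAdmissibleFor γ ((addPolyShear a g).symm F) ↔ IsAdmissibleFor γ F := by
  obtain ⟨N, w, hN, hw⟩ := exists_nat_weights γ hγ
  rw [isAdmissibleFor_iff_le_monomialOrd γ w hN hw, isAdmissibleFor_iff_le_monomialOrd γ w hN hw,
    monomialOrd_addPolyShear_symm_eq w a (by
      rw [killVar_eq_self_of_notMem ha]
      exact le_monomialOrd_of_forall_le_monomialValuation γ w hw a hg)]

end RatWeights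

/-! ## §3 Centre side: replacing `z_a` by `z_a − g(z)` keeps the centre admissible with the same weights -/

section Centre

variable {k : Type*} [Field k] {n : ℕ}

/-- **Centre-side rigidity.** Let `(Ψ, γ)` be a centre for `f` with parameters `zᵢ = Ψ Xᵢ`, and let `g` be free of `X_a`
with `g(0) = 0` and `v_γ(u^d) ≥ γ_a` on every monomial.  Then the parameters `z'_a = z_a − g(z)`, `z'_i = z_i (i ≠ a)` —
the automorphism `(addPolyShear a g).symm.trans Ψ` — with the SAME weights `γ` are again a centre for `f`. (derived here)
[cite: AbramovichTemkinWlodarczyk2024, Lemma 5.2.10 (p. 1577), Thm. 5.3.1 (3) (p. 1578)]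
[cite: CossartJannsenSaito2020, Def. 8.2 / Thm. 8.16 (pp. 118–121)] -/
theorem IsCentreFor.shearParam {f : MvPolynomial (Fin n) k} {Ψ : MvPolynomial (Fin n) k ≃ₐ[k] MvPolynomial (Fin n) k}
    {γ : Fin n → ℚ} (h : IsCentreFor f Ψ γ) (a : Fin n) {g : MvPolynomial (Fin n) k} (ha : a ∉ g.vars)
    (hg0 : constantCoeff g = 0) (hg : ∀ d ∈ g.support, γ a ≤ monomialValuation γ d) :
    IsCentreFor f ((addPolyShear a g).symm.trans Ψ) γ := by
  obtain ⟨hΨ, hγ, hadm⟩ := h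
  refine ⟨fun i => ?_, hγ, ?_⟩
  · rw [AlgEquiv.trans_apply]
    refine constantCoeff_map_eq_zero Ψ hΨ ?_
    exact constantCoeff_symm_X_eq_zero_of_forall _ (constantCoeff_addPolyShear_X a hg0) i
  · rw [AlgEquiv.symm_trans_apply, AlgEquiv.symm_symm]
    exact (isAdmissibleFor_addPolyShear_iff γ hγ a ha hg _).2 hadm

/-- The new parameter is `z'_a = z_a − g(z)` (the others are unchanged). (derived here)
[cite: AbramovichTemkinWlodarczyk2024, Lemma 5.2.10 (p. 1577)] -/
theorem shearParam_X_self (Ψ : MvPolynomial (Fin n) k ≃ₐ[k] MvPolynomial (Fin n) k) (a : Fin n)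
    {g : MvPolynomial (Fin n) k} (ha : a ∉ g.vars) :
    ((addPolyShear a g).symm.trans Ψ) (X a) = Ψ (X a) - Ψ g := by
  have h : (addPolyShear a g).symm (X a : MvPolynomial (Fin n) k) = X a - killVar a g := by
    simp [addPolyShear, sub_eq_add_neg]
  rw [AlgEquiv.trans_apply, h, killVar_eq_self_of_notMem ha, map_sub]

/-- The other parameters are unchanged: `z'_i = z_i`. (derived here) [cite: AbramovichTemkinWlodarczyk2024, Lemma 5.2.10 (p. 1577)] -/
theorem shearParam_X_of_ne (Ψ : MvPolynomial (Fin n) k ≃ₐ[k] MvPolynomial (Fin n) k) (a : Fin n)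
    (g : MvPolynomial (Fin n) k) {i : Fin n} (hi : i ≠ a) :
    ((addPolyShear a g).symm.trans Ψ) (X i) = Ψ (X i) := by
  have h : (addPolyShear a g).symm (X i : MvPolynomial (Fin n) k) = X i := by simp [addPolyShear, hi]
  rw [AlgEquiv.trans_apply, h]

/-- **… and conversely** (the move is invertible with the same bound), so the two parameter systems carry exactly the
same admissible weights. (derived here) [cite: AbramovichTemkinWlodarczyk2024, Lemma 5.2.10 (p. 1577), Thm. 5.3.1 (3) (p. 1578)] -/
theorem IsCentreFor.shearParam_iff {f : MvPolynomial (Fin n) k} (Ψ : MvPolynomial (Fin n) k ≃ₐ[k] MvPolynomial (Fin n) k)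
    {γ : Fin n → ℚ} (hΨ : ∀ i, constantCoeff (Ψ (X i)) = 0) (a : Fin n) {g : MvPolynomial (Fin n) k}
    (ha : a ∉ g.vars) (hg0 : constantCoeff g = 0) (hg : ∀ d ∈ g.support, γ a ≤ monomialValuation γ d) :
    IsCentreFor f ((addPolyShear a g).symm.trans Ψ) γ ↔ IsCentreFor f Ψ γ := by
  refine ⟨fun h => ?_, fun h => h.shearParam a ha hg0 hg⟩
  obtain ⟨-, hγ, hadm⟩ := h
  refine ⟨hΨ, hγ, ?_⟩
  rw [AlgEquiv.symm_trans_apply, AlgEquiv.symm_symm] at hadm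
  exact (isAdmissibleFor_addPolyShear_iff γ hγ a ha hg _).1 hadm

/-- **The invariant is presented by both parameter systems**: `exps γ ∈ W(f)` from the sheared centre. (derived here)
[cite: AbramovichTemkinWlodarczyk2024, Thm. 5.3.1 (2)–(3) (p. 1578)] -/
theorem exps_mem_admissibleInvariants_shearParam {f : MvPolynomial (Fin n) k}
    {Ψ : MvPolynomial (Fin n) k ≃ₐ[k] MvPolynomial (Fin n) k} {γ : Fin n → ℚ} (h : IsCentreFor f Ψ γ) (a : Fin n)
    {g : MvPolynomial (Fin n) k} (ha : a ∉ g.vars) (hg0 : constantCoeff g = 0)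
    (hg : ∀ d ∈ g.support, γ a ≤ monomialValuation γ d) : exps γ ∈ admissibleInvariants f :=
  exps_mem_admissibleInvariants (h.shearParam a ha hg0 hg)

/-! ## §4 A worked instance: the move `y ↦ y + x²` for the weights `γ = (1/2 on x, 1/4 on y)` -/

/-- Instance: `v_γ(x²) = 1 ≥ γ_y = 1/4`, so `γ = (1/2, 1/4)` (the coordinate centre `(x², y⁴)`) is admissible for
`F(x, y + x²)` iff it is admissible for `F`. (derived here) [cite: AbramovichTemkinWlodarczyk2024, Lemma 5.2.10 (p. 1577)] -/
example (F : MvPolynomial (Fin 2) k) :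
    IsAdmissibleFor (fun i : Fin 2 => if i = 0 then (1/2 : ℚ) else 1/4) (addPolyShear 1 (X 0 ^ 2) F) ↔
      IsAdmissibleFor (fun i : Fin 2 => if i = 0 then (1/2 : ℚ) else 1/4) F := by
  classical
  have h10 : (1 : Fin 2) ≠ 0 := by decide
  refine isAdmissibleFor_addPolyShear_iff _ (fun i => by split_ifs <;> norm_num) 1 ?_ ?_ F
  · intro h
    have h' := vars_pow _ _ h
    rw [vars_X, Finset.mem_singleton] at h'
    exact h10 h'
  · intro d hd
    rw [X_pow_eq_monomial, support_monomial, if_neg one_ne_zero, Finset.mem_singleton] at hd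
    subst hd
    rw [monomialValuation, Finsupp.sum_single_index (by simp)]
    simp only [↓reduceIte, if_neg h10]
    norm_num

end Centre

end WeightedBlowup

end Literature.AlgebraicGeometry.Resolution
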